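import Summits.CriticalPhenomena.PercolationContinuityZ3.Theorems.PercHyperscalingGluingFreeBoxShatteringStubUniquenessGluing
import Summits.CriticalPhenomena.PercolationContinuityZ3.Theorems.PercNonProliferationFreeBoxSparseInfiniteGiant

/-!
# Two unglued giants at `p_c(ℤ³)` are two unglued fragments of the infinite cluster
# (supports crux `PercHyperscalingGluing.FreeBoxShattering`, stmt-CriticalPhenomena-4644, line `registered`)

The landed uniqueness-gluing dictionary (`stub_uniquenessGluing`) identifies the crux
`F_r → 0` with `TwoDensePiecesRare`: two sites of `Λ_N` not joined inside `Λ_N`, both with free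
pieces of `≥ δ|Λ_N|` vertices, are asymptotically improbable. This file removes the finite clusters
from that statement, at no cost and at every `p`: a `δ|Λ_N|`-dense free piece rooted at a
NON-percolating site has vanishing probability (the twin's landed
`InfiniteReduction.tendsto_real_exists_finite_dense`, Markov + `P_p(s ≤ |C(0)| < ∞) → 0`), so

* `twoDense_iff_twoDenseInfinite` (every `p`; registered stub `twoDensePiecesRare_iff_infinite` at
  `p_c`): `P_p(two unglued δ-dense pieces in Λ_N) → 0 ⟺ P_p(two unglued δ-dense pieces in Λ_N rooted
  at PERCOLATING sites) → 0`;
* `freeBoxShattering_iff_twoDenseInfinitePiecesRare`: the crux ⟺ for every `δ > 0`, with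
  probability `→ 1` the free box `Λ_N` does not contain two sites of the infinite cluster lying in
  distinct `Λ_N`-pieces of `≥ δ|Λ_N|` vertices each.

So the hypothetical counter-world of the crux is precisely: `θ(p_c) > 0` and, along a subsequence
of scales, two macroscopic `Λ_N`-fragments OF THE INFINITE CLUSTER, unglued inside `Λ_N`, with
non-vanishing probability (each of them hangs on `o(N²)` boundary gateways by
`Literature.Probability.Percolation.BoxGateway.gatewayPairs_small_criticalProbI_three`). Def-free.
Refs: Easo–Hutchcroft arXiv:2112.12778 Rem 1.4 (critical torus giants: open); Grimmett (1999) §8.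
-/

noncomputable section

namespace Summit.CriticalPhenomena.PercolationContinuityZ3.Theorems.FreeBoxShattering

open MeasureTheory Filter
open Literature.Probability.Percolation Literature.Probability.LatticeModels
open scoped Topology Classical
open Summit.CriticalPhenomena.PercolationContinuityZ3.Theses.PercHyperscalingGluing (FreeBoxShattering)
open Summit.CriticalPhenomena.PercolationContinuityZ3.Theorems.FreeBoxSparse.InfiniteReduction
  (tendsto_real_exists_finite_dense)

local notation3 "piece⟦" Λ ", " ω ", " x "⟧" =>
  ((Finset.filter (fun v => (ω : BondConfig (Site 3)) ∈
    openConnIn (↑(Λ : Finset (Site 3)) : Set (Site 3)) x v) Λ).card : ℝ)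
/-- two unglued dense pieces -/
local notation3 "twoDense⟦" Λ ", " θ "⟧" =>
  {ω : BondConfig (Site 3) | ∃ x ∈ (Λ : Finset (Site 3)), ∃ x' ∈ Λ,
    ω ∉ openConnIn (↑Λ : Set (Site 3)) x x' ∧ (θ : ℝ) ≤ piece⟦Λ, ω, x⟧ ∧ (θ : ℝ) ≤ piece⟦Λ, ω, x'⟧}
/-- two unglued dense pieces rooted at percolating sites -/
local notation3 "twoDenseInf⟦" Λ ", " θ "⟧" =>
  {ω : BondConfig (Site 3) | ∃ x ∈ (Λ : Finset (Site 3)), ∃ x' ∈ Λ,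
    ω ∉ openConnIn (↑Λ : Set (Site 3)) x x' ∧ (θ : ℝ) ≤ piece⟦Λ, ω, x⟧ ∧ (θ : ℝ) ≤ piece⟦Λ, ω, x'⟧ ∧
      ω ∈ percolatesAt x ∧ ω ∈ percolatesAt x'}
/-- a dense piece rooted at a non-percolating site -/
local notation3 "finDense⟦" Λ ", " θ "⟧" =>
  {ω : BondConfig (Site 3) | ∃ x ∈ (Λ : Finset (Site 3)), ω ∉ percolatesAt x ∧ (θ : ℝ) ≤ piece⟦Λ, ω, x⟧}

namespace InfinitePieces

/-- Pointwise: two unglued dense pieces are either both rooted at percolating sites, or one of them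
is a dense piece rooted at a non-percolating site. [folklore] -/
theorem twoDense_subset (Λ : Finset (Site 3)) (θ : ℝ) :
    twoDense⟦Λ, θ⟧ ⊆ twoDenseInf⟦Λ, θ⟧ ∪ finDense⟦Λ, θ⟧ := by
  rintro ω ⟨x, hx, x', hx', hne, hpx, hpx'⟩
  by_cases h1 : ω ∈ percolatesAt x
  · by_cases h2 : ω ∈ percolatesAt x'
    · exact Or.inl ⟨x, hx, x', hx', hne, hpx, hpx', h1, h2⟩
    · exact Or.inr ⟨x', hx', h2, hpx'⟩
  · exact Or.inr ⟨x, hx, h1, hpx⟩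

/-- **Every `p`: the finite clusters never produce giants, so two-giant rarity is a statement about
the infinite cluster.** `P_p(twoDense_{δ|Λ_N|}(Λ_N)) → 0 ⟺ P_p(twoDenseInf_{δ|Λ_N|}(Λ_N)) → 0`. [folklore] -/
theorem twoDense_iff_twoDenseInfinite (p : unitInterval) {δ : ℝ} (hδ : 0 < δ) :
    Tendsto (fun N : ℕ => (bondPercolation (zdGraph 3) p).real
        twoDense⟦box 3 N, δ * ((box 3 N).card : ℝ)⟧) atTop (𝓝 0) ↔
      Tendsto (fun N : ℕ => (bondPercolation (zdGraph 3) p).real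
        twoDenseInf⟦box 3 N, δ * ((box 3 N).card : ℝ)⟧) atTop (𝓝 0) := by
  set μ := bondPercolation (zdGraph 3) p with hμ
  have hfin := tendsto_real_exists_finite_dense p hδ
  constructor
  · intro h
    refine squeeze_zero (fun N => measureReal_nonneg) (fun N => ?_) h
    exact measureReal_mono (fun ω ⟨x, hx, x', hx', hne, hpx, hpx', _, _⟩ => ⟨x, hx, x', hx', hne, hpx, hpx'⟩)
  · intro h
    have hsum : Tendsto (fun N : ℕ => μ.real twoDenseInf⟦box 3 N, δ * ((box 3 N).card : ℝ)⟧ +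
        μ.real finDense⟦box 3 N, δ * ((box 3 N).card : ℝ)⟧) atTop (𝓝 0) := by
      simpa using h.add hfin
    refine squeeze_zero (fun N => measureReal_nonneg) (fun N => ?_) hsum
    exact (measureReal_mono (twoDense_subset (box 3 N) _)).trans (measureReal_union_le _ _)

end InfinitePieces

/-- **Registered stub `twoDensePiecesRare_iff_infinite`** (`p = p_c(ℤ³)`, every `δ > 0`): rarity of two
unglued `δ|Λ_N|`-dense free pieces of `Λ_N` is equivalent to rarity of two such pieces rooted at
sites OF THE INFINITE CLUSTER. [folklore] -/
theorem twoDensePiecesRare_iff_infinite : ∀ δ : ℝ, 0 < δ →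
    (Tendsto (fun N : ℕ => (bondPercolation (zdGraph 3) (criticalProbI 3)).real
        {ω : BondConfig (Site 3) | ∃ x ∈ box 3 N, ∃ x' ∈ box 3 N,
          ω ∉ openConnIn (↑(box 3 N) : Set (Site 3)) x x' ∧
          δ * ((box 3 N).card : ℝ) ≤ (((box 3 N).filter fun v => ω ∈ openConnIn (↑(box 3 N) : Set (Site 3)) x v).card : ℝ) ∧
          δ * ((box 3 N).card : ℝ) ≤ (((box 3 N).filter fun v => ω ∈ openConnIn (↑(box 3 N) : Set (Site 3)) x' v).card : ℝ)})
        atTop (𝓝 0) ↔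
      Tendsto (fun N : ℕ => (bondPercolation (zdGraph 3) (criticalProbI 3)).real
        {ω : BondConfig (Site 3) | ∃ x ∈ box 3 N, ∃ x' ∈ box 3 N,
          ω ∉ openConnIn (↑(box 3 N) : Set (Site 3)) x x' ∧
          δ * ((box 3 N).card : ℝ) ≤ (((box 3 N).filter fun v => ω ∈ openConnIn (↑(box 3 N) : Set (Site 3)) x v).card : ℝ) ∧
          δ * ((box 3 N).card : ℝ) ≤ (((box 3 N).filter fun v => ω ∈ openConnIn (↑(box 3 N) : Set (Site 3)) x' v).card : ℝ) ∧
          ω ∈ percolatesAt x ∧ ω ∈ percolatesAt x'}) atTop (𝓝 0)) :=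
  fun _ hδ => InfinitePieces.twoDense_iff_twoDenseInfinite (criticalProbI 3) hδ

/-- **The crux in its sharpest landed form: no two unglued macroscopic fragments of the critical
infinite cluster in a free box.** `FreeBoxShattering ⟺ ∀ δ > 0, P_{p_c}(∃ x, x' ∈ Λ_N ∩ C_∞ in
distinct Λ_N-pieces of ≥ δ|Λ_N| vertices each) → 0` (uniqueness-gluing dictionary + the finite-cluster
reduction above; under `θ(p_c) = 0` the right side is trivially true).
(Easo–Hutchcroft arXiv:2112.12778 Rem. 1.4: the torus form is open.) [folklore] -/
theorem freeBoxShattering_iff_twoDenseInfinitePiecesRare :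
    FreeBoxShattering ↔ ∀ δ : ℝ, 0 < δ →
      Tendsto (fun N : ℕ => (bondPercolation (zdGraph 3) (criticalProbI 3)).real
        twoDenseInf⟦box 3 N, δ * ((box 3 N).card : ℝ)⟧) atTop (𝓝 0) := by
  rw [stub_uniquenessGluing]
  exact forall₂_congr fun δ hδ => InfinitePieces.twoDense_iff_twoDenseInfinite (criticalProbI 3) hδ

end Summit.CriticalPhenomena.PercolationContinuityZ3.Theorems.FreeBoxShattering

end
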